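import Literature.IUT.HodgeTheaters.BadLocalFrobenioidDashSigmaLift
import Literature.IUT.HodgeTheaters.GaloisValDatumCoveringMonoid
import HarnessLib

/-!
# [IUTchI] Ex 3.2 (iv) / Cor 5.3 (iii) — the mono-analytic lift `Ψ⊢_{β,σ}` on the MEMBERS `τ⊢(ζ·q̲_v̲)` of the `μ_{2l}`-orbit `τ⊢_v̲`:
# `Ψ⊢_{β,σ}` carries `τ⊢(ζ·q̲_v̲)` to `τ⊢(σ_K(ζ)·q̲_v̲)` (abc-iut-L5-t4, row «COR53III-BAD-ORBIT», datum-level half; companion of the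
# DEFINITION-FROZEN ★ `BadLocalFrobenioidDashSigmaLift`; PROOF-ONLY — 0 def · 0 instance · 0 notation · no `Prop` fact)

S. Mochizuki, *Inter-universal Teichmüller theory I*, kurims manuscript (May 2020), §3 Example 3.2 (iv) p. 71: «`q̲_v` determines a
`μ_{2l}(−)`-orbit of characteristic splittings [cf. [FrdI], Definition 2.3] `τ⊢_v` on `𝒞⊢_v`»; §5 Corollary 5.3 (iii) p. 144 l. 16–19: «the
natural map `Isom(¹𝔉⊢, ²𝔉⊢) → Isom(¹𝔇⊢, ²𝔇⊢)` […] is surjective». ([IUTchI] Cor 5.3 (iii) p.144; Ex 3.2 (iv) p.71) [claim: Mochizuki2012, status: disputed]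
(D-0012 claim key, series status DISPUTED — THEOREMS about this seat's lift of abc-iut-L5-t2's genuine bad-place datum; nothing of the series is
asserted; no side is taken on [IUTchIII] Cor. 3.12).  S. Mochizuki, *The geometry of Frobenioids II*, Ex. 1.1 (ii) p. 8 (the `K_v`-relative
structure and the fibre product `B`) [cite: MochizukiFrdII2008, Ex 1.1 (ii) p.8].

## What this file proves (cell abc-iut, L5 HUB node `IUTchI:Cor5.3(iii)`, bad `⊢`-slot CONTENT ENRICHMENT «orbit-faithful to Ex 3.2 (iv)», datum level;
## abc-iut-L5-lead 2026-08-27 11:16:19Z GO (O1); count-neutral)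

★ `BadDashSigmaLift.isPreservedBy_tauDashOf_self_lift` says the lift `Ψ⊢_{β,σ}` (★ `BadDashSigmaLift.lift`, from a `β⁻¹`-equivariant integral
multiplicative `σ : Ωˣ → Ωˣ` with inverse `σ'`) preserves the RECORDED member `τ⊢(q̲_v̲)`.  Here, for EVERY unit `ζ` of `𝒪^⊳_{K_v̲}`:
* §A0 generic bookkeeping: the TWO-FAMILY splitting transport `map_cSplittingSubmonoid_eq_of_units₂` (★ one-family form verbatim with `c, c'`);
  `valuation_coe_img_unit` (a unit of `𝒪^⊳_{K_v}` is read as a unit at every object); `relEmb_img_mul`; `units_val_mul_pow_eq_of_pow_eq_one`.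
* §A `exists_unit_algebraMap_eq_sigma` — `σ` carries `K_v̲`-RATIONAL units to `K_v̲`-rational units `ζ ↦ ζ' =: σ_K(ζ)` (`σ(ζ)` is `G_v̲`-fixed,
  `Ω^{G_v̲} = K_v̲` by abc-iut-L5-t2 `forall_galAct_eq_iff_exists_base`), torsion to torsion (`ζ^n = 1 ⇒ ζ'^n = 1`);
  `resK_unit_lift_map_eq_unit_mul` / `resK_unit_eq_of_lift_map_unit_mul` — a base-identity endomorphism has rational function `(ζ q̲)^m` iff its
  image under `Ψ⊢` has rational function `(ζ' q̲)^m` (the brick's `β_A = (τ_A, ĉ ↦ ĉ)` on the unit element `ζ̂_A` times `q̲̂^m`, and the INJECTIVITY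
  ★ `monoMulTransportβ_bijective` for the converse); **`isPreservedBy_tauDashOf_unit_mul_lift`** — `Ψ⊢_{β,σ}` carries `τ⊢(ζ·q̲_v̲)`
  (abc-iut-L5-t2 `GaloisValDatum.tauDashOf hq (ζ·q̲)`) to `τ⊢(ζ'·q̲_v̲)` (`S3Local.CharSplitting.IsPreservedBy`).
CENSUS: binders {`d`, `hq`, `β`, `σ`-package, `ζ`, `ζ'`, `hζ'`} · LAW ∅ · FACT ∅ · side ∅ · DATA ∅.  The MLF / merge-term consequences (with the
anabelian `σ_{β⁻¹}`, orbit to orbit) are the companion `Cor53iiiBadOrbitRider`.  HONEST FRAMING: OUR lift on OUR carrier; typed ≠ inhabited ≠ proved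
beyond what is here; nothing here asserts abc proved or refuted.
-/

noncomputable section

namespace Literature.IUT.HodgeTheaters

open CategoryTheory Opposite Literature.AnabelianGeometry.SemiGraphs Literature.AlgebraicGeometry.Frobenioids
open Literature.AlgebraicGeometry.Frobenioids.PadicFrd
open scoped ValuativeRel

namespace BadDashSigmaLift

universe u

/-! ### §A0. Two generic pieces of `p`-adic Frobenioid bookkeeping -/

section Generic

variable {p : ℕ} [Fact p.Prime]

/-- **Transport of `c`-splittings, TWO-FAMILY form**: if a self-equivalence `Ψ` over a faithful `ΨBase` preserves `deg_Fr` and, for base-identity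
linear endomorphisms, «rational function `= c^m`» at `X` iff «rational function `= c'^m`» at `Ψ X`, then `Ψ` maps the `c`-splitting at `X` ONTO the
`c'`-splitting at `Ψ X` (the one-family ★ `map_cSplittingSubmonoid_eq_of_units`, verbatim with two families). [cite: MochizukiFrdII2008, Rmk 1.2.2 p.10] -/
theorem map_cSplittingSubmonoid_eq_of_units₂ {D : Type u} [Category.{u} D] (d' : PadicFrd.Datum D p)
    (Ψ : d'.frobenioid ≌ d'.frobenioid) (ΨBase : D ⥤ D) [ΨBase.Faithful]
    (η : Ψ.functor ⋙ (ModelFrobenioid.data d'.Φ d'.B d'.divB).base ≅ (ModelFrobenioid.data d'.Φ d'.B d'.divB).base ⋙ ΨBase)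
    (hdeg : ∀ ⦃X Y : d'.frobenioid⦄ (φ : X ⟶ Y), ModelFrobenioid.degFr (Ψ.functor.map φ) = ModelFrobenioid.degFr φ)
    (c c' : ∀ A : D, (d'.fld A)ˣ)
    (H : ∀ (X : d'.frobenioid) (w : X ⟶ X), w ∈ PreFrobenioid.endSubmonoid d'.structureFunctor X → ∀ m : ℕ,
      d'.resK X.base (ModelFrobenioid.unit w) = c X.base ^ m ↔
        d'.resK (Ψ.functor.obj X).base (ModelFrobenioid.unit (Ψ.functor.map w)) = c' (Ψ.functor.obj X).base ^ m)
    (X : d'.frobenioid) :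
    (d'.cSplittingSubmonoid c X).map (Ψ.functor.mapEnd X) = d'.cSplittingSubmonoid c' (Ψ.functor.obj X) := by
  ext w'
  constructor
  · rintro ⟨w, ⟨hw, m, hm⟩, rfl⟩
    exact ⟨(PadicFrd.Datum.map_mem_endSubmonoid_iff d' Ψ ΨBase η hdeg w).mpr hw, m, (H X w hw m).mp hm⟩
  · rintro ⟨hw', m, hm'⟩
    have hpre : Ψ.functor.map (Ψ.functor.preimage (End.asHom w')) = End.asHom w' := Ψ.functor.map_preimage _
    have hw : Ψ.functor.preimage (End.asHom w') ∈ PreFrobenioid.endSubmonoid d'.structureFunctor X :=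
      (PadicFrd.Datum.map_mem_endSubmonoid_iff d' Ψ ΨBase η hdeg _).mp (by rw [hpre]; exact hw')
    refine ⟨Ψ.functor.preimage (End.asHom w'), ⟨hw, m, (H X _ hw m).mpr ?_⟩, hpre⟩
    rw [hpre]
    exact hm'

omit [Fact p.Prime] in
/-- **The image of a UNIT of `𝒪^⊳_{K_v}` under a `K_v`-relative structure has valuation `1`** (both `ζ` and `ζ⁻¹` land in `𝒪^⊳_{K_A}`).
[cite: MochizukiFrdII2008, Ex 1.1 (ii) p.8] -/
theorem valuation_coe_img_unit {D : Type u} [Category.{u} D] {base : D ⥤ PadicFrd.PadicFld.{u} p} {Kv : Type u} [Field Kv] [ValuativeRel Kv]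
    (E : PadicFrd.RelEmb base Kv) (ζ : (intNonzero Kv)ˣ) (A : D) :
    ValuativeRel.valuation (base.obj A).K ((E.img (ζ : intNonzero Kv) A : intNonzero (base.obj A).K) : (base.obj A).K) = 1 := by
  have h2 : ValuativeRel.valuation (base.obj A).K ((E.img ((ζ⁻¹ : (intNonzero Kv)ˣ) : intNonzero Kv) A : intNonzero (base.obj A).K) : (base.obj A).K) ≤ 1 :=
    (E.img _ A).2.1
  have hmul : ((E.img (ζ : intNonzero Kv) A : intNonzero (base.obj A).K) : (base.obj A).K) *
      ((E.img ((ζ⁻¹ : (intNonzero Kv)ˣ) : intNonzero Kv) A : intNonzero (base.obj A).K) : (base.obj A).K) = 1 := by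
    rw [PadicFrd.RelEmb.coe_img, PadicFrd.RelEmb.coe_img, ← map_mul, ← Submonoid.coe_mul, Units.mul_inv, Submonoid.coe_one, map_one]
  have key : ValuativeRel.valuation (base.obj A).K ((E.img (ζ : intNonzero Kv) A : intNonzero (base.obj A).K) : (base.obj A).K) *
      ValuativeRel.valuation (base.obj A).K ((E.img ((ζ⁻¹ : (intNonzero Kv)ˣ) : intNonzero Kv) A : intNonzero (base.obj A).K) : (base.obj A).K) = 1 := by
    rw [← map_mul, hmul, map_one]
  refine le_antisymm (E.img _ A).2.1 ?_
  calc (1 : _) = _ := key.symm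
    _ ≤ ValuativeRel.valuation (base.obj A).K ((E.img (ζ : intNonzero Kv) A : intNonzero (base.obj A).K) : (base.obj A).K) * 1 :=
        mul_le_mul' le_rfl h2
    _ = _ := mul_one _

omit [Fact p.Prime] in
/-- A `K_v`-relative structure reads products as products. [cite: MochizukiFrdII2008, Ex 1.1 (ii) p.8] -/
theorem relEmb_img_mul {D : Type u} [Category.{u} D] {base : D ⥤ PadicFrd.PadicFld.{u} p} {Kv : Type u} [Field Kv] [ValuativeRel Kv]
    (E : PadicFrd.RelEmb base Kv) (a b : intNonzero Kv) (A : D) : E.img (a * b) A = E.img a A * E.img b A :=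
  map_mul _ a b

/-- **The members of the orbit are `2l`-th roots of `q_v`**: `(ζ·q̲)^n = q̲^n` for an `n`-torsion unit `ζ` (so `(ζ·q̲_v)^{2l} = q_v`), in any commutative
monoid. [cite: Mochizuki2012, I Ex 3.2 (iv) p.71] -/
theorem units_val_mul_pow_eq_of_pow_eq_one {M : Type u} [CommMonoid M] (u : Mˣ) (c : M) (n : ℕ) (hu : u ^ n = 1) :
    ((u : M) * c) ^ n = c ^ n := by
  rw [mul_pow, ← Units.val_pow_eq_pow_val, hu, Units.val_one, one_mul]

end Generic

/-! ### §A. The lift `Ψ⊢_{β,σ}` on the members `τ⊢(ζ·q̲_v̲)` of the orbit -/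

section Lift

variable {p : ℕ} [Fact p.Prime] (d : GaloisValDatum.{u} p) {q : PadicFrd.intNonzero d.k} (hq : ¬ IsUnit q)
  (β : d.Gal ≃* d.Gal) (hβc : Continuous β)
  (σ : d.Ωˣ →* d.Ωˣ) (hσ : ∀ (γ : d.Gal) (x : d.Ωˣ), σ (γ • x) = β.symm γ • σ x)
  (hσint : ∀ x : d.Ωˣ, ValuativeRel.valuation d.Ω (x : d.Ω) ≤ 1 → ValuativeRel.valuation d.Ω (σ x : d.Ω) ≤ 1)
  (hσq : ∀ x : d.Ωˣ, (x : d.Ω) = algebraMap d.k d.Ω (q : d.k) →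
    ValuativeRel.valuation d.Ω (σ x : d.Ω) = ValuativeRel.valuation d.Ω (algebraMap d.k d.Ω (q : d.k)))

include hσ hσint in
/-- **`σ` CARRIES `K_v̲`-RATIONAL UNITS TO `K_v̲`-RATIONAL UNITS, torsion to torsion.**  For `ζ ∈ (𝒪^⊳_{K_v̲})^×`: `σ(ζ)` is fixed by `G_v̲` (`σ(ζ) = σ(βγ·ζ)
= γ·σ(ζ)`), hence `K_v̲`-rational (`Ω^{G_v̲} = K_v̲`, abc-iut-L5-t2 `forall_galAct_eq_iff_exists_base`); it is integral with integral inverse `σ(ζ⁻¹)`,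
so a unit `ζ'` of `𝒪^⊳_{K_v̲}`; and `ζ^n = 1 ⇒ ζ'^n = 1` (`σ` multiplicative, `K_v̲ → Ω` injective). [cite: MochizukiAbsAnab2004, Prop 1.2.1 (iv) p.10] -/
theorem exists_unit_algebraMap_eq_sigma (ζ : (intNonzero d.k)ˣ) :
    ∃ ζ' : (intNonzero d.k)ˣ,
      Units.map (algebraMap d.k d.Ω : d.k →* d.Ω) (intNonzeroToUnits d.k (ζ' : intNonzero d.k)) =
        σ (Units.map (algebraMap d.k d.Ω : d.k →* d.Ω) (intNonzeroToUnits d.k (ζ : intNonzero d.k))) ∧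
      ∀ n : ℕ, ζ ^ n = 1 → ζ' ^ n = 1 := by
  -- `σ` of a rational unit is `G_v̲`-fixed, integral and nonzero
  have hfix : ∀ (u : (intNonzero d.k)ˣ) (γ : d.Gal),
      γ • σ (Units.map (algebraMap d.k d.Ω : d.k →* d.Ω) (intNonzeroToUnits d.k (u : intNonzero d.k))) =
        σ (Units.map (algebraMap d.k d.Ω : d.k →* d.Ω) (intNonzeroToUnits d.k (u : intNonzero d.k))) := fun u γ => by
    have h1 : β γ • Units.map (algebraMap d.k d.Ω : d.k →* d.Ω) (intNonzeroToUnits d.k (u : intNonzero d.k)) =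
        Units.map (algebraMap d.k d.Ω : d.k →* d.Ω) (intNonzeroToUnits d.k (u : intNonzero d.k)) :=
      Units.ext ((β γ).commutes ((u : intNonzero d.k) : d.k))
    have key := hσ (β γ) (Units.map (algebraMap d.k d.Ω : d.k →* d.Ω) (intNonzeroToUnits d.k (u : intNonzero d.k)))
    rw [h1, MulEquiv.symm_apply_apply] at key
    exact key.symm
  have hint : ∀ u : (intNonzero d.k)ˣ,
      ((σ (Units.map (algebraMap d.k d.Ω : d.k →* d.Ω) (intNonzeroToUnits d.k (u : intNonzero d.k))) : d.Ωˣ) : d.Ω) ∈ intNonzero d.Ω := fun u =>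
    ⟨hσint _ ((valuation_algebraMap_le_one_iff d.Ω d.k _).mpr (u : intNonzero d.k).2.1), Units.ne_zero _⟩
  have hrat : ∀ u : (intNonzero d.k)ˣ, ∃ a : intNonzero d.k,
      algebraMap d.k d.Ω (a : d.k) = ((σ (Units.map (algebraMap d.k d.Ω : d.k →* d.Ω) (intNonzeroToUnits d.k (u : intNonzero d.k))) : d.Ωˣ) : d.Ω) :=
    fun u => by
    obtain ⟨a, ha⟩ := (d.forall_galAct_eq_iff_exists_base ⟨_, hint u⟩).mp fun γ =>
      (d.galAct_eq_iff γ _).mpr (congrArg (fun w : d.Ωˣ => (w : d.Ω)) (hfix u γ))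
    exact ⟨a, congrArg Subtype.val ha⟩
  obtain ⟨a, ha⟩ := hrat ζ
  obtain ⟨b, hb⟩ := hrat ζ⁻¹
  have hab : a * b = 1 := by
    refine Subtype.ext ((algebraMap d.k d.Ω).injective ?_)
    rw [Submonoid.coe_mul, map_mul, ha, hb, ← Units.val_mul, ← map_mul, ← map_mul, ← map_mul, Units.mul_inv, map_one, map_one, map_one,
      Units.val_one, Submonoid.coe_one, map_one]
  refine ⟨⟨a, b, hab, by rw [mul_comm]; exact hab⟩, Units.ext ha, fun n hn => ?_⟩
  have hy : Units.map (algebraMap d.k d.Ω : d.k →* d.Ω) (intNonzeroToUnits d.k (ζ : intNonzero d.k)) ^ n = 1 := by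
    rw [← map_pow, ← map_pow, ← Units.val_pow_eq_pow_val, hn, Units.val_one, map_one, map_one]
  refine Units.ext (Subtype.ext ((algebraMap d.k d.Ω).injective ?_))
  rw [Units.val_pow_eq_pow_val, SubmonoidClass.coe_pow, map_pow, Units.val_one, OneMemClass.coe_one, map_one]
  change (algebraMap d.k d.Ω (a : d.k)) ^ n = 1
  rw [ha, ← Units.val_pow_eq_pow_val, ← map_pow, hy, map_one, Units.val_one]

/-- `u_{Ψ⊢ w} = β_A(u_w)` for the lift (abc-iut-w5 `DataHomOver.unit_functor_map`, spelled at the brick's `β`-component). [cite: MochizukiFrdI2008, Thm. 6.2 (i) p.110] -/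
private theorem unit_lift_map' {X Y : d.Cdash hq} (w : X ⟶ Y) :
    ModelFrobenioid.unit ((lift d hq β hβc σ hσ hσint hσq).map w) =
      PadicFrd.monoMulTransportβ (DashSigmaLift.baseFunctor₁ d) (DashSigmaLift.baseFunctor₂ d β hβc) (d.relEmb.img q)
        ((relEmbPull d β hβc).img q) (d.relEmb.isConstantSection hq) ((relEmbPull d β hβc).isConstantSection hq) d.fieldFunctor_isPadicLocal
        (GoodLocalFrobenioid.hlocOver (CosetCat.pull (β : d.Gal →* d.Gal) hβc β.surjective) d.fieldFunctor d.fieldFunctor_isPadicLocal)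
        (DashSigmaLift.tau d β hβc σ hσ) (DashSigmaLift.tau_integral d β hβc σ hσ hσint) (tau_img d β hβc σ hσ hσq) (op X.base)
        (ModelFrobenioid.unit w) :=
  (dataHomOver d hq β hβc σ hσ hσint hσq).unit_functor_map w

/-- A `K_v̲`-rational nonzero integer read at the object `X` and then in `Ωˣ` is its image under `K_v̲ → Ω`. [cite: MochizukiFrdII2008, Ex 1.1 (ii) p.8] -/
theorem unitsVal_intNonzeroToUnits_img (ζ : intNonzero d.k) (X : CosetCat d.Gal) :
    SigmaLift.unitsVal d (d.fixedFld X) (intNonzeroToUnits (d.fieldFunctor.obj X).K (d.relEmb.img ζ X)) =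
      Units.map (algebraMap d.k d.Ω : d.k →* d.Ω) (intNonzeroToUnits d.k ζ) :=
  Units.ext rfl

/-- **The unit element `ζ̂_A = (ζ_A, 0)` of `B(A) = 𝒪^×·q̲̂^ℤ`** for a unit `ζ` of `𝒪^⊳_{K_v̲}` (`Div₀(ζ_A) = 0` as `v(ζ_A) = 1`). [cite: MochizukiFrdII2008, Ex 1.1 (ii) p.8] -/
theorem exists_BSub_unit (F : CosetCat d.Gal ⥤ PadicFrd.PadicFld.{u} p) (E : PadicFrd.RelEmb F d.k) (hcs : Monogenic.IsConstantSection F (E.img q))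
    (ζ : (intNonzero d.k)ˣ) (A : CosetCat d.Gal) :
    ∃ z : ↥(Monogenic.BSub F hcs (op A)), z.1.1 = intNonzeroToUnits (F.obj A).K (E.img (ζ : intNonzero d.k) A) ∧ z.1.2 = 1 :=
  ⟨⟨(intNonzeroToUnits (F.obj A).K (E.img (ζ : intNonzero d.k) A), 1), (Monogenic.mem_BSub_iff F hcs (op A) _).mpr (by
      change divZeroHom (F.obj A).K (intNonzeroToUnits (F.obj A).K (E.img (ζ : intNonzero d.k) A)) =
        MonGp.map ((Monogenic.ιc F hcs).app (op A)).hom 1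
      rw [map_one]
      exact divZeroHom_eq_one_of_valuation_eq_one _ (valuation_coe_img_unit E ζ A))⟩, rfl, rfl⟩

/-- `(ζ̂_A^m · q̲̂_A^m)|_{K^×} = (ζ q̲)_A^m`. [cite: MochizukiFrdII2008, Ex 1.1 (ii) p.8] -/
theorem resK_unit_mul_liftGen_pow (ζ : (intNonzero d.k)ˣ) (A : CosetCat d.Gal)
    (z : ↥(Monogenic.BSub (DashSigmaLift.baseFunctor₁ d) (d.relEmb.isConstantSection hq) (op A)))
    (hz : z.1.1 = intNonzeroToUnits (d.fieldFunctor.obj A).K (d.relEmb.img (ζ : intNonzero d.k) A)) (m : ℕ) :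
    (d.dashDatum hq).resK A (z ^ m * Monogenic.liftGen (DashSigmaLift.baseFunctor₁ d) (d.relEmb.isConstantSection hq) (op A) ^ m) =
      intNonzeroToUnits (d.fieldFunctor.obj A).K (d.relEmb.img ((ζ : intNonzero d.k) * q) A) ^ m := by
  have hz' : (d.dashDatum hq).resK A z = intNonzeroToUnits (d.fieldFunctor.obj A).K (d.relEmb.img (ζ : intNonzero d.k) A) := hz
  have himg : intNonzeroToUnits (d.fieldFunctor.obj A).K (d.relEmb.img ((ζ : intNonzero d.k) * q) A) ^ m =
      intNonzeroToUnits (d.fieldFunctor.obj A).K (d.relEmb.img (ζ : intNonzero d.k) A) ^ m *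
        intNonzeroToUnits (d.fieldFunctor.obj A).K (d.relEmb.img q A) ^ m := by
    rw [relEmb_img_mul, map_mul, mul_pow]
  exact (((d.dashDatum hq).resK A).map_mul _ _).trans
    ((congrArg₂ (· * ·) ((((d.dashDatum hq).resK A).map_pow _ m).trans (congrArg (· ^ m) hz')) (resK_liftGen_pow d hq A m)).trans
      himg.symm)

include hσ in
/-- **`β_A(ζ̂^m · q̲̂^m)|_{K^×} = (σ_K(ζ) q̲)^m` at the pulled-back object**: `β_A = (τ_A, ĉ ↦ ĉ)` is multiplicative, `β_A(q̲̂) = q̲̂`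
(★ `monoMulTransportβ_liftGen`), and `τ_A(ζ_A) = σ(ζ) = ζ'` read in `Ω`. [cite: MochizukiFrdII2008, Ex 1.1 (ii) p.8] -/
theorem resK_monoMulTransportβ_unit_mul_liftGen_pow (ζ ζ' : (intNonzero d.k)ˣ)
    (hζ' : Units.map (algebraMap d.k d.Ω : d.k →* d.Ω) (intNonzeroToUnits d.k (ζ' : intNonzero d.k)) =
      σ (Units.map (algebraMap d.k d.Ω : d.k →* d.Ω) (intNonzeroToUnits d.k (ζ : intNonzero d.k))))
    (A : CosetCat d.Gal) (z : ↥(Monogenic.BSub (DashSigmaLift.baseFunctor₁ d) (d.relEmb.isConstantSection hq) (op A)))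
    (hz : z.1.1 = intNonzeroToUnits (d.fieldFunctor.obj A).K (d.relEmb.img (ζ : intNonzero d.k) A)) (hz2 : z.1.2 = 1) (m : ℕ) :
    (d.dashDatum hq).resK ((CosetCat.pull (β : d.Gal →* d.Gal) hβc β.surjective).obj A)
        (PadicFrd.monoMulTransportβ (DashSigmaLift.baseFunctor₁ d) (DashSigmaLift.baseFunctor₂ d β hβc) (d.relEmb.img q)
          ((relEmbPull d β hβc).img q) (d.relEmb.isConstantSection hq) ((relEmbPull d β hβc).isConstantSection hq) d.fieldFunctor_isPadicLocal
          (GoodLocalFrobenioid.hlocOver (CosetCat.pull (β : d.Gal →* d.Gal) hβc β.surjective) d.fieldFunctor d.fieldFunctor_isPadicLocal)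
          (DashSigmaLift.tau d β hβc σ hσ) (DashSigmaLift.tau_integral d β hβc σ hσ hσint) (tau_img d β hβc σ hσ hσq) (op A)
          (z ^ m * Monogenic.liftGen (DashSigmaLift.baseFunctor₁ d) (d.relEmb.isConstantSection hq) (op A) ^ m)) =
      intNonzeroToUnits (d.fieldFunctor.obj ((CosetCat.pull (β : d.Gal →* d.Gal) hβc β.surjective).obj A)).K
          (d.relEmb.img ((ζ' : intNonzero d.k) * q) ((CosetCat.pull (β : d.Gal →* d.Gal) hβc β.surjective).obj A)) ^ m := by
  -- `β_A(ζ̂^m q̲̂^m) = β_A(ζ̂)^m q̲̂^m` inside `B(β⁻¹A)`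
  have hβprod : PadicFrd.monoMulTransportβ (DashSigmaLift.baseFunctor₁ d) (DashSigmaLift.baseFunctor₂ d β hβc) (d.relEmb.img q)
        ((relEmbPull d β hβc).img q) (d.relEmb.isConstantSection hq) ((relEmbPull d β hβc).isConstantSection hq) d.fieldFunctor_isPadicLocal
        (GoodLocalFrobenioid.hlocOver (CosetCat.pull (β : d.Gal →* d.Gal) hβc β.surjective) d.fieldFunctor d.fieldFunctor_isPadicLocal)
        (DashSigmaLift.tau d β hβc σ hσ) (DashSigmaLift.tau_integral d β hβc σ hσ hσint) (tau_img d β hβc σ hσ hσq) (op A)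
        (z ^ m * Monogenic.liftGen (DashSigmaLift.baseFunctor₁ d) (d.relEmb.isConstantSection hq) (op A) ^ m) =
      PadicFrd.monoMulTransportβ (DashSigmaLift.baseFunctor₁ d) (DashSigmaLift.baseFunctor₂ d β hβc) (d.relEmb.img q)
        ((relEmbPull d β hβc).img q) (d.relEmb.isConstantSection hq) ((relEmbPull d β hβc).isConstantSection hq) d.fieldFunctor_isPadicLocal
        (GoodLocalFrobenioid.hlocOver (CosetCat.pull (β : d.Gal →* d.Gal) hβc β.surjective) d.fieldFunctor d.fieldFunctor_isPadicLocal)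
        (DashSigmaLift.tau d β hβc σ hσ) (DashSigmaLift.tau_integral d β hβc σ hσ hσint) (tau_img d β hβc σ hσ hσq) (op A) z ^ m *
      Monogenic.liftGen (DashSigmaLift.baseFunctor₂ d β hβc) ((relEmbPull d β hβc).isConstantSection hq) (op A) ^ m := by
    rw [map_mul, map_pow, map_pow, PadicFrd.monoMulTransportβ_liftGen]
  -- `β_A(ζ̂)|_{K^×} = τ_A(ζ_A) = ζ'_{β⁻¹A}`
  have hfst : ∀ y : ↥(Monogenic.BSub (DashSigmaLift.baseFunctor₂ d β hβc) ((relEmbPull d β hβc).isConstantSection hq) (op A)),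
      (d.dashDatum hq).resK ((CosetCat.pull (β : d.Gal →* d.Gal) hβc β.surjective).obj A) y = y.1.1 := fun _ => rfl
  have hτ : DashSigmaLift.tau d β hβc σ hσ A (intNonzeroToUnits (d.fieldFunctor.obj A).K (d.relEmb.img (ζ : intNonzero d.k) A)) =
      intNonzeroToUnits ((DashSigmaLift.baseFunctor₂ d β hβc).obj A).K ((relEmbPull d β hβc).img (ζ' : intNonzero d.k) A) := by
    refine SigmaLift.unitsVal_injective d (d.fixedFld ((CosetCat.pull (β : d.Gal →* d.Gal) hβc β.surjective).obj A)) ?_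
    rw [DashSigmaLift.unitsVal_tau, unitsVal_intNonzeroToUnits_img]
    exact hζ'.symm.trans
      (unitsVal_intNonzeroToUnits_img d (ζ' : intNonzero d.k) ((CosetCat.pull (β : d.Gal →* d.Gal) hβc β.surjective).obj A)).symm
  have h1 : (d.dashDatum hq).resK ((CosetCat.pull (β : d.Gal →* d.Gal) hβc β.surjective).obj A)
      (PadicFrd.monoMulTransportβ (DashSigmaLift.baseFunctor₁ d) (DashSigmaLift.baseFunctor₂ d β hβc) (d.relEmb.img q)
        ((relEmbPull d β hβc).img q) (d.relEmb.isConstantSection hq) ((relEmbPull d β hβc).isConstantSection hq) d.fieldFunctor_isPadicLocal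
        (GoodLocalFrobenioid.hlocOver (CosetCat.pull (β : d.Gal →* d.Gal) hβc β.surjective) d.fieldFunctor d.fieldFunctor_isPadicLocal)
        (DashSigmaLift.tau d β hβc σ hσ) (DashSigmaLift.tau_integral d β hβc σ hσ hσint) (tau_img d β hβc σ hσ hσq) (op A) z) =
      intNonzeroToUnits ((DashSigmaLift.baseFunctor₂ d β hβc).obj A).K ((relEmbPull d β hβc).img (ζ' : intNonzero d.k) A) := by
    refine (hfst _).trans ((PadicFrd.monoMulTransportβ_fst (DashSigmaLift.baseFunctor₁ d) (DashSigmaLift.baseFunctor₂ d β hβc) (d.relEmb.img q)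
        ((relEmbPull d β hβc).img q) (d.relEmb.isConstantSection hq) ((relEmbPull d β hβc).isConstantSection hq) d.fieldFunctor_isPadicLocal
        (GoodLocalFrobenioid.hlocOver (CosetCat.pull (β : d.Gal →* d.Gal) hβc β.surjective) d.fieldFunctor d.fieldFunctor_isPadicLocal)
        (DashSigmaLift.tau d β hβc σ hσ) (DashSigmaLift.tau_integral d β hβc σ hσ hσint) (tau_img d β hβc σ hσ hσq) (op A) z).trans ?_)
    refine (congrArg₂ (fun a b => DashSigmaLift.tau d β hβc σ hσ A a *
        PadicFrd.monoCorr (DashSigmaLift.baseFunctor₁ d) (DashSigmaLift.baseFunctor₂ d β hβc) (d.relEmb.img q) ((relEmbPull d β hβc).img q)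
          (d.relEmb.isConstantSection hq) d.fieldFunctor_isPadicLocal (DashSigmaLift.tau d β hβc σ hσ) A b) hz hz2).trans ?_
    refine (congrArg (fun t => DashSigmaLift.tau d β hβc σ hσ A (intNonzeroToUnits (d.fieldFunctor.obj A).K (d.relEmb.img (ζ : intNonzero d.k) A)) * t)
      (map_one (PadicFrd.monoCorr (DashSigmaLift.baseFunctor₁ d) (DashSigmaLift.baseFunctor₂ d β hβc) (d.relEmb.img q)
        ((relEmbPull d β hβc).img q) (d.relEmb.isConstantSection hq) d.fieldFunctor_isPadicLocal (DashSigmaLift.tau d β hβc σ hσ) A))).trans ?_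
    exact (mul_one _).trans hτ
  have h2 : (d.dashDatum hq).resK ((CosetCat.pull (β : d.Gal →* d.Gal) hβc β.surjective).obj A)
      (Monogenic.liftGen (DashSigmaLift.baseFunctor₂ d β hβc) ((relEmbPull d β hβc).isConstantSection hq) (op A)) =
      intNonzeroToUnits ((DashSigmaLift.baseFunctor₂ d β hβc).obj A).K ((relEmbPull d β hβc).img q A) := rfl
  -- `(ζ' q̲)_{β⁻¹A}^m = ζ'^m q̲^m`
  have himg : intNonzeroToUnits ((DashSigmaLift.baseFunctor₂ d β hβc).obj A).K ((relEmbPull d β hβc).img ((ζ' : intNonzero d.k) * q) A) ^ m =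
      intNonzeroToUnits ((DashSigmaLift.baseFunctor₂ d β hβc).obj A).K ((relEmbPull d β hβc).img (ζ' : intNonzero d.k) A) ^ m *
        intNonzeroToUnits ((DashSigmaLift.baseFunctor₂ d β hβc).obj A).K ((relEmbPull d β hβc).img q A) ^ m := by
    rw [relEmb_img_mul, map_mul, mul_pow]
  exact (congrArg _ hβprod).trans
    ((((d.dashDatum hq).resK ((CosetCat.pull (β : d.Gal →* d.Gal) hβc β.surjective).obj A)).map_mul _ _).trans
      ((congrArg₂ (· * ·)
        ((((d.dashDatum hq).resK ((CosetCat.pull (β : d.Gal →* d.Gal) hβc β.surjective).obj A)).map_pow _ m).trans (congrArg (· ^ m) h1))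
        ((((d.dashDatum hq).resK ((CosetCat.pull (β : d.Gal →* d.Gal) hβc β.surjective).obj A)).map_pow _ m).trans (congrArg (· ^ m) h2))).trans
        himg.symm))

include hσ in
/-- **`H`, forward, for the member `τ⊢(ζ q̲)`**: if a base-identity linear endomorphism `w` of `A` has rational function `(ζ q̲)^m`, then `Ψ⊢ w` has
rational function `(σ_K(ζ) q̲)^m` — `u_w = ζ̂^m q̲̂^m` by injectivity of `u ↦ u|_{K^×}`, then `u_{Ψ⊢ w} = β_A(u_w)`. [cite: MochizukiFrdII2008, Thm 1.2 (v) p.10] -/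
theorem resK_unit_lift_map_eq_unit_mul (ζ ζ' : (intNonzero d.k)ˣ)
    (hζ' : Units.map (algebraMap d.k d.Ω : d.k →* d.Ω) (intNonzeroToUnits d.k (ζ' : intNonzero d.k)) =
      σ (Units.map (algebraMap d.k d.Ω : d.k →* d.Ω) (intNonzeroToUnits d.k (ζ : intNonzero d.k))))
    {X : d.Cdash hq} (w : X ⟶ X) (m : ℕ)
    (hw : (d.dashDatum hq).resK X.base (ModelFrobenioid.unit w) =
      intNonzeroToUnits (d.fieldFunctor.obj X.base).K (d.relEmb.img ((ζ : intNonzero d.k) * q) X.base) ^ m) :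
    (d.dashDatum hq).resK ((CosetCat.pull (β : d.Gal →* d.Gal) hβc β.surjective).obj X.base)
        (ModelFrobenioid.unit ((lift d hq β hβc σ hσ hσint hσq).map w)) =
      intNonzeroToUnits (d.fieldFunctor.obj ((CosetCat.pull (β : d.Gal →* d.Gal) hβc β.surjective).obj X.base)).K
          (d.relEmb.img ((ζ' : intNonzero d.k) * q) ((CosetCat.pull (β : d.Gal →* d.Gal) hβc β.surjective).obj X.base)) ^ m := by
  obtain ⟨z, hz, hz2⟩ := exists_BSub_unit d (DashSigmaLift.baseFunctor₁ d) d.relEmb (d.relEmb.isConstantSection hq) ζ X.base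
  have hu : (ModelFrobenioid.unit w : ↥(Monogenic.BSub (DashSigmaLift.baseFunctor₁ d) (d.relEmb.isConstantSection hq) (op X.base))) =
      z ^ m * Monogenic.liftGen (DashSigmaLift.baseFunctor₁ d) (d.relEmb.isConstantSection hq) (op X.base) ^ m :=
    (d.dashDatum hq).resK_injective X.base (hw.trans (resK_unit_mul_liftGen_pow d hq ζ X.base z hz m).symm)
  rw [unit_lift_map' d hq β hβc σ hσ hσint hσq, hu]
  exact resK_monoMulTransportβ_unit_mul_liftGen_pow d hq β hβc σ hσ hσint hσq ζ ζ' hζ' X.base z hz hz2 m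

variable (hβc' : Continuous β.symm) (σ' : d.Ωˣ →* d.Ωˣ) (hσ' : ∀ (γ : d.Gal) (x : d.Ωˣ), σ' (γ • x) = β γ • σ' x)
  (hσ'int : ∀ x : d.Ωˣ, ValuativeRel.valuation d.Ω (x : d.Ω) ≤ 1 → ValuativeRel.valuation d.Ω (σ' x : d.Ω) ≤ 1)
  (hσ'q : ∀ x : d.Ωˣ, (x : d.Ω) = algebraMap d.k d.Ω (q : d.k) →
    ValuativeRel.valuation d.Ω (σ' x : d.Ω) = ValuativeRel.valuation d.Ω (algebraMap d.k d.Ω (q : d.k)))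
  (hinv : ∀ x, σ' (σ x) = x) (hinv' : ∀ x, σ (σ' x) = x)

include hσ σ' hσ' hσ'int hσ'q hinv hinv' in
/-- **`H`, backward, for the member `τ⊢(ζ q̲)`**: if `Ψ⊢ w` has rational function `(σ_K(ζ) q̲)^m` then `w` has rational function `(ζ q̲)^m` —
`β_A(u_w) = β_A(ζ̂^m q̲̂^m)` by injectivity of `u ↦ u|_{K^×}` at `β⁻¹A` and the forward computation, then INJECTIVITY of `β_A`
(★ `monoMulTransportβ_bijective`, from the integral inverse `σ'`). [cite: MochizukiFrdII2008, Thm 1.2 (v) p.10] -/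
theorem resK_unit_eq_of_lift_map_unit_mul (ζ ζ' : (intNonzero d.k)ˣ)
    (hζ' : Units.map (algebraMap d.k d.Ω : d.k →* d.Ω) (intNonzeroToUnits d.k (ζ' : intNonzero d.k)) =
      σ (Units.map (algebraMap d.k d.Ω : d.k →* d.Ω) (intNonzeroToUnits d.k (ζ : intNonzero d.k))))
    {X : d.Cdash hq} (w : X ⟶ X) (m : ℕ)
    (hw' : (d.dashDatum hq).resK ((CosetCat.pull (β : d.Gal →* d.Gal) hβc β.surjective).obj X.base)
        (ModelFrobenioid.unit ((lift d hq β hβc σ hσ hσint hσq).map w)) =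
      intNonzeroToUnits (d.fieldFunctor.obj ((CosetCat.pull (β : d.Gal →* d.Gal) hβc β.surjective).obj X.base)).K
          (d.relEmb.img ((ζ' : intNonzero d.k) * q) ((CosetCat.pull (β : d.Gal →* d.Gal) hβc β.surjective).obj X.base)) ^ m) :
    (d.dashDatum hq).resK X.base (ModelFrobenioid.unit w) =
      intNonzeroToUnits (d.fieldFunctor.obj X.base).K (d.relEmb.img ((ζ : intNonzero d.k) * q) X.base) ^ m := by
  obtain ⟨z, hz, hz2⟩ := exists_BSub_unit d (DashSigmaLift.baseFunctor₁ d) d.relEmb (d.relEmb.isConstantSection hq) ζ X.base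
  have hβu : PadicFrd.monoMulTransportβ (DashSigmaLift.baseFunctor₁ d) (DashSigmaLift.baseFunctor₂ d β hβc) (d.relEmb.img q)
        ((relEmbPull d β hβc).img q) (d.relEmb.isConstantSection hq) ((relEmbPull d β hβc).isConstantSection hq) d.fieldFunctor_isPadicLocal
        (GoodLocalFrobenioid.hlocOver (CosetCat.pull (β : d.Gal →* d.Gal) hβc β.surjective) d.fieldFunctor d.fieldFunctor_isPadicLocal)
        (DashSigmaLift.tau d β hβc σ hσ) (DashSigmaLift.tau_integral d β hβc σ hσ hσint) (tau_img d β hβc σ hσ hσq) (op X.base)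
        (ModelFrobenioid.unit w) =
      PadicFrd.monoMulTransportβ (DashSigmaLift.baseFunctor₁ d) (DashSigmaLift.baseFunctor₂ d β hβc) (d.relEmb.img q)
        ((relEmbPull d β hβc).img q) (d.relEmb.isConstantSection hq) ((relEmbPull d β hβc).isConstantSection hq) d.fieldFunctor_isPadicLocal
        (GoodLocalFrobenioid.hlocOver (CosetCat.pull (β : d.Gal →* d.Gal) hβc β.surjective) d.fieldFunctor d.fieldFunctor_isPadicLocal)
        (DashSigmaLift.tau d β hβc σ hσ) (DashSigmaLift.tau_integral d β hβc σ hσ hσint) (tau_img d β hβc σ hσ hσq) (op X.base)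
        (z ^ m * Monogenic.liftGen (DashSigmaLift.baseFunctor₁ d) (d.relEmb.isConstantSection hq) (op X.base) ^ m) := by
    refine (d.dashDatum hq).resK_injective ((CosetCat.pull (β : d.Gal →* d.Gal) hβc β.surjective).obj X.base) ?_
    rw [← unit_lift_map' d hq β hβc σ hσ hσint hσq, hw']
    exact (resK_monoMulTransportβ_unit_mul_liftGen_pow d hq β hβc σ hσ hσint hσq ζ ζ' hζ' X.base z hz hz2 m).symm
  have hu : (ModelFrobenioid.unit w : ↥(Monogenic.BSub (DashSigmaLift.baseFunctor₁ d) (d.relEmb.isConstantSection hq) (op X.base))) =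
      z ^ m * Monogenic.liftGen (DashSigmaLift.baseFunctor₁ d) (d.relEmb.isConstantSection hq) (op X.base) ^ m :=
    (PadicFrd.monoMulTransportβ_bijective (DashSigmaLift.baseFunctor₁ d) (DashSigmaLift.baseFunctor₂ d β hβc)
      (d.relEmb.img q) ((relEmbPull d β hβc).img q) (d.relEmb.isConstantSection hq) ((relEmbPull d β hβc).isConstantSection hq)
      d.fieldFunctor_isPadicLocal
      (GoodLocalFrobenioid.hlocOver (CosetCat.pull (β : d.Gal →* d.Gal) hβc β.surjective) d.fieldFunctor d.fieldFunctor_isPadicLocal)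
      (DashSigmaLift.tau d β hβc σ hσ) (DashSigmaLift.tau_integral d β hβc σ hσ hσint) (tau_img d β hβc σ hσ hσq)
      (DashSigmaLift.tau' d β hβc σ' hσ') (DashSigmaLift.tau'_integral d β hβc σ' hσ' hσ'int) (tau'_img d β hβc σ' hσ' hσ'q)
      (DashSigmaLift.tau'_tau d β hβc σ hσ σ' hσ' hinv) (DashSigmaLift.tau_tau' d β hβc σ hσ σ' hσ' hinv') (op X.base)).1 hβu
  rw [hu]
  exact resK_unit_mul_liftGen_pow d hq ζ X.base z hz m

include hβc' hσ' hσ'int hσ'q hinv hinv' in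
/-- **THE LIFT CARRIES `τ⊢(ζ·q̲_v̲)` TO `τ⊢(σ_K(ζ)·q̲_v̲)`** — for every unit `ζ` of `𝒪^⊳_{K_v̲}` and its `σ`-image `ζ'`: the member of the orbit `τ⊢_v̲`
determined by the root `ζ·q̲_v̲` (abc-iut-L5-t2 `GaloisValDatum.tauDashOf`) is carried by `Ψ⊢_{β,σ}` onto the member determined by `ζ'·q̲_v̲`
(two-family splitting transport, base data `(pull β, lift_comp_CdashBase)`, `H` = the two lemmas above).
([IUTchI] Cor 5.3 (iii) p.144; Ex 3.2 (iv) p.71) [claim: Mochizuki2012, status: disputed] -/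
theorem isPreservedBy_tauDashOf_unit_mul_lift (ζ ζ' : (intNonzero d.k)ˣ)
    (hζ' : Units.map (algebraMap d.k d.Ω : d.k →* d.Ω) (intNonzeroToUnits d.k (ζ' : intNonzero d.k)) =
      σ (Units.map (algebraMap d.k d.Ω : d.k →* d.Ω) (intNonzeroToUnits d.k (ζ : intNonzero d.k)))) :
    (d.tauDashOf hq ((ζ : intNonzero d.k) * q)).IsPreservedBy (d.tauDashOf hq ((ζ' : intNonzero d.k) * q))
      (lift d hq β hβc σ hσ hσint hσq) := by
  intro X
  have ha : ∀ ξ : (intNonzero d.k)ˣ, Associated ((ξ : intNonzero d.k) * q) q := fun ξ =>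
    ⟨ξ⁻¹, by rw [mul_comm (ξ : intNonzero d.k) q, mul_assoc, Units.mul_inv, mul_one]⟩
  rw [d.tauDashOf_sect hq _ (ha ζ) X, d.tauDashOf_sect hq _ (ha ζ')]
  haveI := lift_isEquivalence d hq β hβc σ hσ hσint hσq hβc' σ' hσ' hσ'int hσ'q hinv hinv'
  haveI : (CosetCat.pull (β : d.Gal →* d.Gal) hβc β.surjective).Faithful := CosetCat.pull_faithful _ _ _
  exact map_cSplittingSubmonoid_eq_of_units₂ (d.dashDatum hq) (lift d hq β hβc σ hσ hσint hσq).asEquivalence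
    (CosetCat.pull (β : d.Gal →* d.Gal) hβc β.surjective) (eqToIso (lift_comp_CdashBase d hq β hβc σ hσ hσint hσq)) (fun _ _ _ => rfl)
    (fun A => intNonzeroToUnits (d.fieldFunctor.obj A).K (d.relEmb.img ((ζ : intNonzero d.k) * q) A))
    (fun A => intNonzeroToUnits (d.fieldFunctor.obj A).K (d.relEmb.img ((ζ' : intNonzero d.k) * q) A))
    (fun Y w _ m => ⟨resK_unit_lift_map_eq_unit_mul d hq β hβc σ hσ hσint hσq ζ ζ' hζ' w m,
      resK_unit_eq_of_lift_map_unit_mul d hq β hβc σ hσ hσint hσq σ' hσ' hσ'int hσ'q hinv hinv' ζ ζ' hζ' w m⟩) X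

end Lift

end BadDashSigmaLift

end Literature.IUT.HodgeTheaters

end
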